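import Mathlib
import HarnessLib
import Summits.Ventures.LatticeQCDFlow.Exactness.SphereGradientFlowDescent

/-!
# The pull-back derivative along the sphere gradient flow: `(d/ds) H(Φ_{c−s}x) = D(H∘Φ_{c−s})(x)·∂̃G(x) = Σ_n ⟪∂̃_n(H∘Φ_{c−s})(x), ∂̃_nG(x)⟫` on `Ω`

HONEST FRAMING: exact (Metropolis-corrected) sampling algorithms for lattice gauge theory;
figures of merit are autocorrelation/cost numbers at stated couplings and volumes; no
continuum-physics claim.

Venture `LatticeQCDFlow` (cell pub-lqcd), topic `Exactness`; FANOUT row 7 (`s0-cpn-null`: the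
S0-D1 rung — Lüscher's trivializing flow for the lattice CP(N−1)/O(N) action, Engel–Schaefer 2011,
integrated by Euler steps inside HMC).  NEW WORK of the cell over the tree's
`Exactness/SphereGradientFlow.lean` (the global flow `Φ_t` of `ẋ_n = −∂̃_nG(x)` on the lattice of
site spheres: group law, joint `C¹` smoothness, the true equation on `Ω̃`),
`Exactness/SphereGradientFlowDescent.lean` (`DF(x)·w = Σ_k D_kF(x)·w_k`) and
`Exactness/SphereLuscherSeriesExistence.lean` (E–S eq. (12) paired:
`⟪∂̃_kF, h⟫ = D_kF·h − ⟪x_k, h⟫E_kF`); nothing is cited as a fact.  Printed counterpart, NAMED ONLY: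
M. Lüscher, Commun. Math. Phys. 293 (2010) 899, §3 (the field transformation generated by the flow
and the substitution rule for observables); Engel–Schaefer, Comput. Phys. Commun. 182 (2011) 2107,
§3 eq. (14).

This file is the pointwise (configuration-by-configuration) calculus behind the TRANSPORT IDENTITY
of the sequel `Exactness/SphereFlowTransport.lean` (the rate at which the law transported by
`Φ_t` departs from the tilted family `e^{−tS}π̄/Z_t`):

* §1 **`fderiv_apply_eq_sum_inner_siteGrad`**: on `Ω̃ = {‖x_n‖ = 1 ∀n}` the differential of a
  functional paired with a TANGENT vector field is the sum of the site pairings with E–S's natural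
  gradients, `DK(x)·V = Σ_n ⟪∂̃_nK(x), V_n⟫` (`⟪x_n, V_n⟫ = 0`); in particular
  `DK(x)·∂̃G(x) = Σ_n ⟪∂̃_nK(x), ∂̃_nG(x)⟫` (**`fderiv_apply_siteGrad_eq_sum_inner`**).
* §2 **THE PULL-BACK DERIVATIVE**: for `G ∈ C²` with flow `Φ`, `H` differentiable and `x ∈ Ω̃`,
  `s ↦ H(Φ_{c−s}(x))` has derivative `D(H∘Φ_{c−s})(x)·∂̃G(x)` at every `s`
  (**`hasDerivAt_comp_sphereGradientFlow_sub`**; group law `Φ_{c−s'} = Φ_{c−s}∘Φ_{s−s'}` and the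
  chain rule at `s' = s`, where `(d/ds')Φ_{s−s'}(x) = +∂̃G(x)`), `= Σ_n ⟪∂̃_n(H∘Φ_{c−s})(x), ∂̃_nG(x)⟫`
  (**`hasDerivAt_comp_sphereGradientFlow_sub_sum`**) — the derivative with respect to the INITIAL
  time is the differential of the composite observable paired with the generator at the initial
  point, which is what the tilted Green identity integrates by parts.
* §3 regularity of the composite observable: `H∘Φ_t ∈ C¹`, joint continuity of
  `(s, ω) ↦ H(Φ_{c−s}ω)` and of `(s, ω) ↦ D(H∘Φ_{c−s})(ω)·∂̃G(ω)` on `ℝ × Ω`.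

NOT CLAIMED: anything about the Jacobian of `Φ_t`; time-dependent generators; anything
quantitative.
-/

noncomputable section

namespace Summit.Ventures.LatticeQCDFlow.Exactness

open Function Set Metric MeasureTheory NormedSpace InnerProductSpace
open scoped RealInnerProductSpace Topology

variable {Λ : Type*} {E : Type*} [NormedAddCommGroup E] [InnerProductSpace ℝ E]
  [FiniteDimensional ℝ E] [Fintype Λ] [DecidableEq Λ]

/-! ## §1 The differential paired with a tangent field -/

section Tangent

/-- **`DK(x)·V = Σ_n ⟪∂̃_nK(x), V_n⟫` for a tangent field on `Ω̃`**: if `‖x_n‖ = 1` and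
`⟪x_n, V_n⟫ = 0` for all `n`, the differential of `K` at `x` applied to `V` is the sum over the
sites of the pairings with E–S's natural gradients (E–S eq. (12): `∂̃_nK` is the tangential
projection of the site gradient). -/
theorem fderiv_apply_eq_sum_inner_siteGrad {K : (Λ → E) → ℝ} {x : Λ → E} (hx : ∀ n, ‖x n‖ = 1)
    (hK : DifferentiableAt ℝ K x) {V : Λ → E} (hV : ∀ n, ⟪x n, V n⟫ = 0) :
    fderiv ℝ K x V = ∑ n, ⟪siteGrad n K x, V n⟫ := by
  rw [fderiv_apply_eq_sum_siteDeriv hK V]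
  refine Finset.sum_congr rfl fun n _ => ?_
  have hsec : DifferentiableAt ℝ (fun y => K (update x n y)) (x n) := by
    have hK' : DifferentiableAt ℝ K (update x n (x n)) := by rwa [update_eq_self]
    exact hK'.comp (x n) (hasFDerivAt_update x (x n)).differentiableAt
  rw [inner_siteGrad (hx n) hsec, hV n, zero_mul, sub_zero]

/-- **`DK(x)·∂̃G(x) = Σ_n ⟪∂̃_nK(x), ∂̃_nG(x)⟫` on `Ω̃`**: the natural gradient field of a
differentiable `G` is tangent (`⟪x_n, ∂̃_nG(x)⟫ = 0`). -/
theorem fderiv_apply_siteGrad_eq_sum_inner {K G : (Λ → E) → ℝ} {x : Λ → E} (hx : ∀ n, ‖x n‖ = 1)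
    (hK : DifferentiableAt ℝ K x) (hG : Differentiable ℝ G) :
    fderiv ℝ K x (fun n => siteGrad n G x) = ∑ n, ⟪siteGrad n K x, siteGrad n G x⟫ :=
  fderiv_apply_eq_sum_inner_siteGrad hx hK fun n =>
    inner_self_siteGrad (hx n) ((hG.comp (contDiff_update 1 x n).differentiable_one) (x n))

end Tangent

/-! ## §2 The pull-back derivative along the flow -/

section Pullback

variable {G : (Λ → E) → ℝ}

/-- The group law read backwards: `Φ_{c−s'}(x) = Φ_{c−s}(Φ_{s−s'}(x))`. -/
theorem sphereGradientFlow_sub_eq (hG : ContDiff ℝ 2 G) (x : Λ → E) (c s s' : ℝ) :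
    sphereGradientFlow hG x (c - s') =
      sphereGradientFlow hG (sphereGradientFlow hG x (s - s')) (c - s) := by
  rw [← sphereGradientFlow_add, show s - s' + (c - s) = c - s' by ring]

/-- On `Ω̃`, `s' ↦ Φ_{s−s'}(x)` passes through `x` at `s' = s` with velocity `+∂̃G(x)` (the flow
runs backwards in `s'`). -/
theorem hasDerivAt_sphereGradientFlow_sub (hG : ContDiff ℝ 2 G) {x : Λ → E} (hx : ∀ n, ‖x n‖ = 1)
    (s : ℝ) :
    HasDerivAt (fun s' => sphereGradientFlow hG x (s - s')) (fun n => siteGrad n G x) s := by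
  have h := hasDerivAt_sphereGradientFlow hG hx (s - s)
  have h2 : HasDerivAt (fun s' : ℝ => s - s') (-1) s := by
    simpa using (hasDerivAt_id s).const_sub s
  have h3 := h.scomp s h2
  have e : ((-1 : ℝ) • fun n => -siteGrad n G (sphereGradientFlow hG x (s - s))) =
      fun n => siteGrad n G x := by
    funext n
    simp only [sub_self, sphereGradientFlow_zero, Pi.smul_apply, neg_smul, one_smul, neg_neg]
  rw [e] at h3
  exact h3

/-- `x ↦ Φ_t(x)` is `C¹` on the ambient space, for every fixed `t`. -/
theorem contDiff_sphereGradientFlow_apply (hG : ContDiff ℝ 2 G) (t : ℝ) :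
    ContDiff ℝ 1 fun z : Λ → E => sphereGradientFlow hG z t :=
  (contDiff_sphereGradientFlow hG).comp (contDiff_id.prodMk contDiff_const)

/-- `x ↦ Φ_t(x)` is differentiable on the ambient space. -/
theorem differentiable_sphereGradientFlow_apply (hG : ContDiff ℝ 2 G) (t : ℝ) :
    Differentiable ℝ fun z : Λ → E => sphereGradientFlow hG z t :=
  (contDiff_sphereGradientFlow_apply hG t).differentiable one_ne_zero

/-- **THE PULL-BACK DERIVATIVE.**  For `G ∈ C²` with sphere gradient flow `Φ`, `H` differentiable
and `x ∈ Ω̃`: `s ↦ H(Φ_{c−s}(x))` has derivative `D(H∘Φ_{c−s})(x)·∂̃G(x)` at every `s` — the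
derivative with respect to the initial time is the differential of the composite observable at the
initial point paired with the generator there. -/
theorem hasDerivAt_comp_sphereGradientFlow_sub (hG : ContDiff ℝ 2 G) {H : (Λ → E) → ℝ}
    (hH : Differentiable ℝ H) {x : Λ → E} (hx : ∀ n, ‖x n‖ = 1) (c s : ℝ) :
    HasDerivAt (fun s' => H (sphereGradientFlow hG x (c - s')))
      (fderiv ℝ (fun z => H (sphereGradientFlow hG z (c - s))) x (fun n => siteGrad n G x)) s := by
  have hK : DifferentiableAt ℝ (fun z => H (sphereGradientFlow hG z (c - s))) x :=
    (hH.comp (differentiable_sphereGradientFlow_apply hG (c - s))) x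
  have hγ := hasDerivAt_sphereGradientFlow_sub hG hx s
  have hx0 : sphereGradientFlow hG x (s - s) = x := by rw [sub_self, sphereGradientFlow_zero]
  have hK' : HasFDerivAt (fun z => H (sphereGradientFlow hG z (c - s)))
      (fderiv ℝ (fun z => H (sphereGradientFlow hG z (c - s))) x)
        (sphereGradientFlow hG x (s - s)) := by
    rw [hx0]; exact hK.hasFDerivAt
  have h := hK'.comp_hasDerivAt s hγ
  refine h.congr_of_eventuallyEq (Filter.Eventually.of_forall fun s' => ?_)
  show H (sphereGradientFlow hG x (c - s')) =
    H (sphereGradientFlow hG (sphereGradientFlow hG x (s - s')) (c - s))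
  rw [← sphereGradientFlow_sub_eq]

/-- **THE PULL-BACK DERIVATIVE, SITE FORM**: `(d/ds) H(Φ_{c−s}(x)) = Σ_n ⟪∂̃_n(H∘Φ_{c−s})(x), ∂̃_nG(x)⟫`
on `Ω̃` (`G ∈ C²`, `H` differentiable). -/
theorem hasDerivAt_comp_sphereGradientFlow_sub_sum (hG : ContDiff ℝ 2 G) {H : (Λ → E) → ℝ}
    (hH : Differentiable ℝ H) {x : Λ → E} (hx : ∀ n, ‖x n‖ = 1) (c s : ℝ) :
    HasDerivAt (fun s' => H (sphereGradientFlow hG x (c - s')))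
      (∑ n, ⟪siteGrad n (fun z => H (sphereGradientFlow hG z (c - s))) x, siteGrad n G x⟫) s := by
  have h := hasDerivAt_comp_sphereGradientFlow_sub hG hH hx c s
  have hK : DifferentiableAt ℝ (fun z => H (sphereGradientFlow hG z (c - s))) x :=
    (hH.comp (differentiable_sphereGradientFlow_apply hG (c - s))) x
  rwa [fderiv_apply_siteGrad_eq_sum_inner hx hK (hG.differentiable (by norm_num))] at h

/-- At `s = c` (no flow left to run) the pull-back derivative is `DH(x)·∂̃G(x) = Σ_n ⟪∂̃_nH, ∂̃_nG⟫`: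
the infinitesimal substitution rule. -/
theorem hasDerivAt_comp_sphereGradientFlow_sub_self (hG : ContDiff ℝ 2 G) {H : (Λ → E) → ℝ}
    (hH : Differentiable ℝ H) {x : Λ → E} (hx : ∀ n, ‖x n‖ = 1) (c : ℝ) :
    HasDerivAt (fun s' => H (sphereGradientFlow hG x (c - s')))
      (∑ n, ⟪siteGrad n H x, siteGrad n G x⟫) c := by
  have h := hasDerivAt_comp_sphereGradientFlow_sub_sum hG hH hx c c
  simp only [sub_self, sphereGradientFlow_zero] at h
  exact h

end Pullback

/-! ## §3 Regularity of the composite observable -/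

section Regularity

variable {G : (Λ → E) → ℝ}

/-- `H ∘ Φ_t ∈ C¹` for `H ∈ C¹`. -/
theorem contDiff_comp_sphereGradientFlow_apply (hG : ContDiff ℝ 2 G) {H : (Λ → E) → ℝ}
    (hH : ContDiff ℝ 1 H) (t : ℝ) :
    ContDiff ℝ 1 fun z : Λ → E => H (sphereGradientFlow hG z t) :=
  hH.comp (contDiff_sphereGradientFlow_apply hG t)

/-- `(s, z) ↦ H(Φ_{c−s}(z))` is jointly `C¹` (`H ∈ C¹`). -/
theorem contDiff_comp_sphereGradientFlow_sub_uncurry (hG : ContDiff ℝ 2 G) {H : (Λ → E) → ℝ}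
    (hH : ContDiff ℝ 1 H) (c : ℝ) :
    ContDiff ℝ 1 fun q : ℝ × (Λ → E) => H (sphereGradientFlow hG q.2 (c - q.1)) :=
  hH.comp ((contDiff_sphereGradientFlow hG).comp
    (contDiff_snd.prodMk (contDiff_const.sub contDiff_fst)))

/-- `(s, ω) ↦ H(Φ_{c−s}(ω))` is continuous on `ℝ × Ω` (`H ∈ C¹`). -/
theorem continuous_comp_sphereGradientFlow_sub_sphereConfig (hG : ContDiff ℝ 2 G)
    {H : (Λ → E) → ℝ} (hH : ContDiff ℝ 1 H) (c : ℝ) :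
    Continuous fun p : ℝ × (Λ → sphere (0 : E) 1) =>
      H (sphereGradientFlow hG (fun m => (p.2 m : E)) (c - p.1)) :=
  (contDiff_comp_sphereGradientFlow_sub_uncurry hG hH c).continuous.comp
    (continuous_fst.prodMk (continuous_sphereConfig.comp continuous_snd))

/-- `(s, z) ↦ D(H∘Φ_{c−s})(z)` is continuous (as a map into the dual), `H ∈ C¹`. -/
theorem continuous_fderiv_comp_sphereGradientFlow_sub (hG : ContDiff ℝ 2 G) {H : (Λ → E) → ℝ}
    (hH : ContDiff ℝ 1 H) (c : ℝ) :
    Continuous fun q : ℝ × (Λ → E) =>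
      fderiv ℝ (fun z => H (sphereGradientFlow hG z (c - q.1))) q.2 := by
  have h : ContDiff ℝ 1 (uncurry fun (q : ℝ × (Λ → E)) (z : Λ → E) =>
      H (sphereGradientFlow hG z (c - q.1))) :=
    hH.comp ((contDiff_sphereGradientFlow hG).comp
      (contDiff_snd.prodMk (contDiff_const.sub (contDiff_fst.comp contDiff_fst))))
  exact Continuous.fderiv_one h continuous_snd

/-- **`(s, ω) ↦ D(H∘Φ_{c−s})(ω)·∂̃G(ω)` is continuous on `ℝ × Ω`** (`H ∈ C¹`, `G ∈ C²`) — the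
joint continuity of the pull-back derivative needed to differentiate under `∫dπ̄`. -/
theorem continuous_fderiv_comp_sphereGradientFlow_sub_apply_siteGrad (hG : ContDiff ℝ 2 G)
    {H : (Λ → E) → ℝ} (hH : ContDiff ℝ 1 H) (c : ℝ) :
    Continuous fun p : ℝ × (Λ → sphere (0 : E) 1) =>
      fderiv ℝ (fun z => H (sphereGradientFlow hG z (c - p.1))) (fun m => (p.2 m : E))
        (fun n => siteGrad n G (fun m => (p.2 m : E))) := by
  have h1 := (continuous_fderiv_comp_sphereGradientFlow_sub hG hH c).comp
    (continuous_fst.prodMk (continuous_sphereConfig.comp continuous_snd) :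
      Continuous fun p : ℝ × (Λ → sphere (0 : E) 1) => (p.1, fun m => (p.2 m : E)))
  have h2 : Continuous fun p : ℝ × (Λ → sphere (0 : E) 1) =>
      fun n => siteGrad n G (fun m => (p.2 m : E)) :=
    continuous_pi fun n =>
      (continuous_siteGrad_sphereConfig (hG.of_le (by norm_num)) n).comp continuous_snd
  exact h1.clm_apply h2

end Regularity

end Summit.Ventures.LatticeQCDFlow.Exactness

end
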